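import Summits.Ventures.Crystal3D.Theorems.StickyWulffConstantTextureLiminfFluxChart
import HarnessLib

/-!
# The PRISM CHART of a layer: volume of a layer slab as an integral over in-layer lines
# (LAYER-FLUX chain piece 2, booked cf-p1 ROUTE.md §86(72) BO; crux `TextureLiminf`, stmt-Ventures-19483)

HONEST FRAMING. Venture `Summits/Ventures/Crystal3D` (cell `crystal3d-full`), helper `--supports` the crux
`TextureLiminf` (stmt-Ventures-19483) of `route-Ventures-StickyWulffConstant`, registered line `TexShadow`.  Rung credit
only; F-C1 not moved.  Pure measure theory (a linear change of variables + Fubini), the in-layer twin of `…FluxChart`.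

For two HORIZONTAL model vectors `w, w'` (`w₂ = w'₂ = 0`) with `d := w₀ w'₁ − w₁ w'₀ > 0` and a base point `Γ`:
* `layLin w w' : y ↦ y₀ w + y₁ w' + y₂ e₃`, `det_layLin = d`; `layChart Γ w w' y := layLin w w' y + Γ`,
  `layChart_apply_two` (= Γ₂ + y₂);
* `volume_inter_slab_eq_layChart` — `|S ∩ {Γ₂ < p₂ < Γ₂ + η}| = d · |{y : layChart y ∈ S, 0 < y₂ < η}|`;
* split coordinates `layChart' Γ w w' (τ, x) := τ w + x₀ w' + x₁ e₃ + Γ` (lines along `w`, parameter `τ`), and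
  **`volume_inter_slab_eq_lintegral_layChart`** — `|S ∩ slab| = d · ∫⁻ x : ℝ², |{τ : layChart' (τ, x) ∈ S}| · 1[0 < x₁ < η]`
  written as `∫⁻ x, |{τ | layChart' (τ,x) ∈ S ∧ 0 < x 1 ∧ x 1 < η}|`.
The in-layer line count (`…LayerCount`) instantiates `w = bestLayerDir`, `w' =` its 60°-partner (`d = √3/2`), `η = √(2/3)`.
WHAT THIS IS NOT: not the count; F-C1 not moved.
-/

noncomputable section

namespace Summit.Ventures.Crystal3D.Theorems

open MeasureTheory Set
open scoped ENNReal InnerProductSpace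
open Summit.Ventures.Crystal3D.Cruxes.TextureLiminf.TexShadow (E3 e₃)

/-! ## The linear part and its determinant -/

/-- The linear part of the prism chart: `y ↦ y₀ w + y₁ w' + y₂ e₃`. -/
def layLin (w w' : E3) : E3 →ₗ[ℝ] E3 :=
  (EuclideanSpace.proj (0 : Fin 3)).toLinearMap.smulRight w +
    (EuclideanSpace.proj (1 : Fin 3)).toLinearMap.smulRight w' +
    (EuclideanSpace.proj (2 : Fin 3)).toLinearMap.smulRight e₃

/-- The linear part, unfolded. -/
theorem layLin_apply (w w' y : E3) : layLin w w' y = (y 0) • w + (y 1) • w' + (y 2) • e₃ := by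
  simp [layLin, LinearMap.smulRight_apply]

/-- Coordinates of the linear part for horizontal `w, w'`. -/
theorem layLin_apply_coord (w w' : E3) (hw : w 2 = 0) (hw' : w' 2 = 0) (y : E3) :
    layLin w w' y 0 = y 0 * w 0 + y 1 * w' 0 ∧ layLin w w' y 1 = y 0 * w 1 + y 1 * w' 1 ∧ layLin w w' y 2 = y 2 := by
  rw [layLin_apply]
  refine ⟨?_, ?_, ?_⟩
  · simp [e₃]
  · simp [e₃]
  · simp [e₃, hw, hw']

/-- **The determinant of the prism chart is `w₀ w'₁ − w₁ w'₀`.** -/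
theorem det_layLin (w w' : E3) (hw : w 2 = 0) (hw' : w' 2 = 0) :
    LinearMap.det (layLin w w') = w 0 * w' 1 - w 1 * w' 0 := by
  classical
  rw [← LinearMap.det_toMatrix (EuclideanSpace.basisFun (Fin 3) ℝ).toBasis, Matrix.det_fin_three]
  have hentry : ∀ i j : Fin 3, LinearMap.toMatrix (EuclideanSpace.basisFun (Fin 3) ℝ).toBasis
      (EuclideanSpace.basisFun (Fin 3) ℝ).toBasis (layLin w w') i j = layLin w w' (EuclideanSpace.single j 1) i := by
    intro i j
    rw [LinearMap.toMatrix_apply, OrthonormalBasis.coe_toBasis_repr_apply, EuclideanSpace.basisFun_repr,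
      OrthonormalBasis.coe_toBasis, EuclideanSpace.basisFun_apply]
  simp only [hentry]
  have h0 := layLin_apply_coord w w' hw hw' (EuclideanSpace.single 0 1)
  have h1 := layLin_apply_coord w w' hw hw' (EuclideanSpace.single 1 1)
  have h2 := layLin_apply_coord w w' hw hw' (EuclideanSpace.single 2 1)
  simp only [PiLp.single_apply] at h0 h1 h2
  simp only [Fin.isValue, ↓reduceIte, one_ne_zero, zero_ne_one, Fin.reduceEq] at h0 h1 h2
  rw [h0.1, h0.2.1, h0.2.2, h1.1, h1.2.1, h1.2.2, h2.1, h2.2.1, h2.2.2]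
  ring

/-! ## The chart and the slab -/

/-- The prism chart with base point `Γ`: `y ↦ y₀ w + y₁ w' + y₂ e₃ + Γ`. -/
def layChart (Γ w w' : E3) (y : E3) : E3 := layLin w w' y + Γ

/-- The height of the chart: `(layChart y)₂ = Γ₂ + y₂`. -/
theorem layChart_apply_two (Γ w w' : E3) (hw : w 2 = 0) (hw' : w' 2 = 0) (y : E3) :
    layChart Γ w w' y 2 = Γ 2 + y 2 := by
  rw [layChart, PiLp.add_apply, (layLin_apply_coord w w' hw hw' y).2.2]; ring

/-- The chart is continuous. -/
theorem continuous_layChart (Γ w w' : E3) : Continuous (layChart Γ w w') :=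
  ((layLin w w').continuous_of_finiteDimensional).add continuous_const

/-- **The volume of a set inside one layer slab, through the prism chart** (`d = w₀w'₁ − w₁w'₀ > 0`). -/
theorem volume_inter_slab_eq_layChart (Γ w w' : E3) (hw : w 2 = 0) (hw' : w' 2 = 0)
    (hd : 0 < w 0 * w' 1 - w 1 * w' 0) (η : ℝ) (S : Set E3) :
    volume (S ∩ {p : E3 | Γ 2 < p 2 ∧ p 2 < Γ 2 + η}) =
      ENNReal.ofReal (w 0 * w' 1 - w 1 * w' 0) * volume {y : E3 | layChart Γ w w' y ∈ S ∧ 0 < y 2 ∧ y 2 < η} := by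
  have hdet : LinearMap.det (layLin w w') = w 0 * w' 1 - w 1 * w' 0 := det_layLin w w' hw hw'
  have hdet0 : LinearMap.det (layLin w w') ≠ 0 := by rw [hdet]; exact ne_of_gt hd
  have hpre : {y : E3 | layChart Γ w w' y ∈ S ∧ 0 < y 2 ∧ y 2 < η} =
      (layLin w w') ⁻¹' ((fun p => p + Γ) ⁻¹' (S ∩ {p : E3 | Γ 2 < p 2 ∧ p 2 < Γ 2 + η})) := by
    ext y
    simp only [Set.mem_setOf_eq, Set.mem_preimage, Set.mem_inter_iff]
    rw [show layLin w w' y + Γ = layChart Γ w w' y from rfl, layChart_apply_two Γ w w' hw hw']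
    constructor
    · rintro ⟨hS', h0, h1⟩; exact ⟨hS', by linarith, by linarith⟩
    · rintro ⟨hS', h0, h1⟩; exact ⟨hS', by linarith, by linarith⟩
  rw [hpre, MeasureTheory.Measure.addHaar_preimage_linearMap _ hdet0, measure_preimage_add_right, hdet,
    ← mul_assoc, ← ENNReal.ofReal_mul (le_of_lt hd), abs_of_pos (inv_pos.2 hd), mul_inv_cancel₀ (ne_of_gt hd),
    ENNReal.ofReal_one, one_mul]

/-! ## The slab volume as an integral over the in-layer lines -/

/-- The chart in split coordinates `(τ, x) ∈ ℝ × ℝ²`: `τ w + x₀ w' + x₁ e₃ + Γ` (lines along `w`). -/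
def layChart' (Γ w w' : E3) (p : ℝ × (Fin 2 → ℝ)) : E3 := p.1 • w + (p.2 0) • w' + (p.2 1) • e₃ + Γ

/-- The chart is continuous in split coordinates. -/
theorem continuous_layChart' (Γ w w' : E3) : Continuous (layChart' Γ w w') := by
  unfold layChart'
  fun_prop

/-- Split coordinates: `layChart` is `layChart'` after `y ↦ (y₀, (y₁, y₂))`. -/
theorem layChart_eq_layChart' (Γ w w' y : E3) :
    layChart Γ w w' y = layChart' Γ w w' ((MeasurableEquiv.piFinSuccAbove (fun _ : Fin 3 => ℝ) 0) (WithLp.ofLp y)) := by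
  rw [layChart, layLin_apply, layChart']
  simp [MeasurableEquiv.piFinSuccAbove, Fin.tail]

/-- **The volume of a set inside one layer slab is an integral over the in-layer lines:**
`|S ∩ {Γ₂ < p₂ < Γ₂ + η}| = d · ∫⁻ x : ℝ², |{τ : layChart' (τ, x) ∈ S ∧ 0 < x₁ < η}|`. -/
theorem volume_inter_slab_eq_lintegral_layChart (Γ w w' : E3) (hw : w 2 = 0) (hw' : w' 2 = 0)
    (hd : 0 < w 0 * w' 1 - w 1 * w' 0) (η : ℝ) (S : Set E3) (hS : MeasurableSet S) :
    volume (S ∩ {p : E3 | Γ 2 < p 2 ∧ p 2 < Γ 2 + η}) =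
      ENNReal.ofReal (w 0 * w' 1 - w 1 * w' 0) *
        ∫⁻ x : Fin 2 → ℝ, volume {τ : ℝ | layChart' Γ w w' (τ, x) ∈ S ∧ 0 < x 1 ∧ x 1 < η} := by
  rw [volume_inter_slab_eq_layChart Γ w w' hw hw' hd η S]
  congr 1
  set A' : Set (ℝ × (Fin 2 → ℝ)) := {p | layChart' Γ w w' p ∈ S ∧ 0 < p.2 1 ∧ p.2 1 < η} with hA'
  have hA'meas : MeasurableSet A' := by
    have h1 : MeasurableSet (layChart' Γ w w' ⁻¹' S) := (continuous_layChart' Γ w w').measurable hS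
    have hm : Measurable fun p : ℝ × (Fin 2 → ℝ) => p.2 1 := (measurable_pi_apply 1).comp measurable_snd
    have h2 : MeasurableSet {p : ℝ × (Fin 2 → ℝ) | 0 < p.2 1} := measurableSet_lt measurable_const hm
    have h3 : MeasurableSet {p : ℝ × (Fin 2 → ℝ) | p.2 1 < η} := measurableSet_lt hm measurable_const
    have : A' = (layChart' Γ w w' ⁻¹' S) ∩ {p | 0 < p.2 1} ∩ {p | p.2 1 < η} := by
      ext p; simp [hA', and_assoc]
    rw [this]; exact (h1.inter h2).inter h3
  have hset : {y : E3 | layChart Γ w w' y ∈ S ∧ 0 < y 2 ∧ y 2 < η} =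
      (WithLp.ofLp : E3 → (Fin 3 → ℝ)) ⁻¹' ((MeasurableEquiv.piFinSuccAbove (fun _ : Fin 3 => ℝ) 0) ⁻¹' A') := by
    ext y
    simp only [Set.mem_setOf_eq, Set.mem_preimage, hA']
    rw [layChart_eq_layChart']
    simp [MeasurableEquiv.piFinSuccAbove, Fin.tail]
  rw [hset, (PiLp.volume_preserving_ofLp (Fin 3)).measure_preimage
      (((MeasurableEquiv.piFinSuccAbove (fun _ : Fin 3 => ℝ) 0).measurable hA'meas).nullMeasurableSet),
    (volume_preserving_piFinSuccAbove (fun _ : Fin 3 => ℝ) 0).measure_preimage hA'meas.nullMeasurableSet,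
    show (volume : Measure (ℝ × (Fin 2 → ℝ))) = volume.prod volume from rfl, Measure.prod_apply_symm hA'meas]
  rfl

end Summit.Ventures.Crystal3D.Theorems

end
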